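import Summits.AtomisticToContinuum.Crystallization.Theorems.FreeSplittingCertificatesStrictSplittingRuleDefs
import Summits.AtomisticToContinuum.Crystallization.Theorems.PricedLinkCensusStackingHingeBarlowShellSupport
import Summits.AtomisticToContinuum.Crystallization.Theorems.GappedShellCensusCleanLimitsHaveWindowsRelDense

/-!
# `FiniteRangeSplitting` (stmt-AtomisticToContinuum-12559): the addition theorem for `P₁ … P₅` on `S²`, in closed rational form

Support file for crux r2 of route `FreeSplittingCertificates` (block-2b unit `b2b-freesplit-A`, gen 13).
VALUE = kernel-checked algebra feeding Delsarte's bound (`…RadiusLadderDelsarte`) and through it the layer cake of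
`…RadiusLadderHalfRule54` (certified hard-core threshold of the half rule lowered from `4/3` to `5/4`) — NOT summit
progress.

* `legP1 … legP5` — the Legendre polynomials `P₁,…,P₅`.
* `harmk`, `lamk` (`k = 1…5`) — an explicit INTEGER basis of the harmonic polynomials of degree `k` on `ℝ³`
  (`2k+1` of them, orthogonal for the rotation-invariant Fischer product `⟨p,q⟩ = p(∂)q`) and positive RATIONAL
  weights, such that the ADDITION THEOREM holds in the closed form
  `P_k(⟪x,y⟫) = Σ_m λ_{k,m} h_{k,m}(x) h_{k,m}(y)` for unit `x y` (`legPk_inner_eq`: a polynomial identity modulo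
  `‖x‖ = ‖y‖ = 1`, checked by `linear_combination`; bases and weights computed exactly by
  `run/shared/lean/b2b/freesplit-r2/code/gen13_delsarte/harmonics.py`).
* `sum_sum_legPk_nonneg` — hence `P_k` IS POSITIVE DEFINITE on `S²` [Schoenberg 1942]:
  `Σ_{i∈s} Σ_{j∈s} P_k(⟪u_i,u_j⟫) = Σ_m λ_m (Σ_{i∈s} h_m(u_i))² ≥ 0` (`sum_sum_nonneg_of_gram`).  No measure theory,
  no special functions: this is what makes Delsarte's linear-programming bound available to the kernel.
-/

noncomputable section

namespace Summit.AtomisticToContinuum.Crystallization.Theorems.StrictSplittingRuleBirth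

open scoped BigOperators

/-! ## Coordinates on `E3`

The coordinate form of the inner product (`real_inner_eq_sum_three`) and the unit-sphere relation
(`sum_sq_eq_one_of_norm_eq_one`) are reused from the landed modules
`PricedLinkCensusStackingHingeBarlowShellSupport` / `GappedShellCensusCleanLimitsHaveWindowsRelDense`. -/

open Summit.AtomisticToContinuum.Crystallization.Theorems.PricedHcpWindowsBarlowShellSupport (real_inner_eq_sum_three)
open Summit.AtomisticToContinuum.Crystallization.Theorems.CleanHull (sum_sq_eq_one_of_norm_eq_one)

/-- `⟪x, x⟫ = 1` for a unit vector. -/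
theorem inner_self_eq_one_of_norm {x : EuclideanSpace ℝ (Fin 3)} (hx : ‖x‖ = 1) : inner ℝ x x = 1 := by
  rw [real_inner_self_eq_norm_sq, hx, one_pow]

/-! ## Sums of Gram-type kernels are nonnegative -/

/-- A kernel that is a nonnegative combination of products `h_m(i) h_m(j)` has nonnegative double sum over any
finite index set: `Σ_{i∈s} Σ_{j∈s} g i j = Σ_m λ_m (Σ_{i∈s} h_m i)² ≥ 0`. -/
theorem sum_sum_nonneg_of_gram {ι : Type*} {M : ℕ} (s : Finset ι) (g : ι → ι → ℝ) (lam : Fin M → ℝ)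
    (h : Fin M → ι → ℝ) (hlam : ∀ m, 0 ≤ lam m) (hg : ∀ i ∈ s, ∀ j ∈ s, g i j = ∑ m, lam m * h m i * h m j) :
    0 ≤ ∑ i ∈ s, ∑ j ∈ s, g i j := by
  have e : ∑ i ∈ s, ∑ j ∈ s, g i j = ∑ m, lam m * (∑ i ∈ s, h m i) ^ 2 :=
    calc ∑ i ∈ s, ∑ j ∈ s, g i j = ∑ i ∈ s, ∑ j ∈ s, ∑ m, lam m * h m i * h m j :=
          Finset.sum_congr rfl fun i hi => Finset.sum_congr rfl fun j hj => hg i hi j hj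
      _ = ∑ i ∈ s, ∑ m, ∑ j ∈ s, lam m * h m i * h m j :=
          Finset.sum_congr rfl fun i _ => Finset.sum_comm
      _ = ∑ m, ∑ i ∈ s, ∑ j ∈ s, lam m * h m i * h m j := Finset.sum_comm
      _ = ∑ m, lam m * (∑ i ∈ s, h m i) ^ 2 := by
          refine Finset.sum_congr rfl fun m _ => ?_
          rw [sq, Finset.sum_mul_sum, Finset.mul_sum]
          refine Finset.sum_congr rfl fun i _ => ?_
          rw [Finset.mul_sum]
          refine Finset.sum_congr rfl fun j _ => ?_
          ring
  rw [e]
  exact Finset.sum_nonneg fun m _ => mul_nonneg (hlam m) (sq_nonneg _)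

/-! ## The Legendre polynomials `P₁ … P₅` and the addition theorem in closed form -/

/-- `P₁(t) = t`. -/
def legP1 (t : ℝ) : ℝ := t

/-- `P₂(t) = (3t² − 1)/2`. -/
def legP2 (t : ℝ) : ℝ := (3 * t ^ 2 - 1) / 2

/-- `P₃(t) = (5t³ − 3t)/2`. -/
def legP3 (t : ℝ) : ℝ := (5 * t ^ 3 - 3 * t) / 2

/-- `P₄(t) = (35t⁴ − 30t² + 3)/8`. -/
def legP4 (t : ℝ) : ℝ := (35 * t ^ 4 - 30 * t ^ 2 + 3) / 8

/-- `P₅(t) = (63t⁵ − 70t³ + 15t)/8`. -/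
def legP5 (t : ℝ) : ℝ := (63 * t ^ 5 - 70 * t ^ 3 + 15 * t) / 8

/-! ### Unrolled `Fin` sums -/


/-- A sum over `Fin 3`, unrolled. -/
theorem sum_fin3 (f : Fin 3 → ℝ) : ∑ m, f m = f 0 + f 1 + f 2 := by
  simp [Fin.sum_univ_succ]; ring
/-- A sum over `Fin 5`, unrolled. -/
theorem sum_fin5 (f : Fin 5 → ℝ) : ∑ m, f m = f 0 + f 1 + f 2 + f 3 + f 4 := by
  simp [Fin.sum_univ_succ]; ring
/-- A sum over `Fin 7`, unrolled. -/
theorem sum_fin7 (f : Fin 7 → ℝ) : ∑ m, f m = f 0 + f 1 + f 2 + f 3 + f 4 + f 5 + f 6 := by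
  simp [Fin.sum_univ_succ]; ring
/-- A sum over `Fin 9`, unrolled. -/
theorem sum_fin9 (f : Fin 9 → ℝ) : ∑ m, f m = f 0 + f 1 + f 2 + f 3 + f 4 + f 5 + f 6 + f 7 + f 8 := by
  simp [Fin.sum_univ_succ]; ring
/-- A sum over `Fin 11`, unrolled. -/
theorem sum_fin11 (f : Fin 11 → ℝ) :
    ∑ m, f m = f 0 + f 1 + f 2 + f 3 + f 4 + f 5 + f 6 + f 7 + f 8 + f 9 + f 10 := by
  simp [Fin.sum_univ_succ]; ring

/-! ### Degree `1` -/
/-- An integer basis of the harmonic polynomials of degree `1` on `ℝ³` (`3` of them), orthogonal for the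
rotation-invariant (Fischer) inner product, read on the coordinates of a vector of `ℝ³`. -/
def harm1 : Fin 3 → EuclideanSpace ℝ (Fin 3) → ℝ
  | ⟨0, _⟩, x => (x 0)
  | ⟨1, _⟩, x => (x 1)
  | ⟨2, _⟩, x => (x 2)

/-- The (positive, rational) addition-theorem weights of `harm1`. -/
def lam1 : Fin 3 → ℝ
  | ⟨0, _⟩ => (1 : ℝ)
  | ⟨1, _⟩ => (1 : ℝ)
  | ⟨2, _⟩ => (1 : ℝ)

/-- `P1` on the Gram entries of unit vectors is the explicit sum of products `Σ_m λ_m h_m(x) h_m(y)` (addition theorem,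
degree `1`, with rational weights). -/
theorem legP1_inner_eq (x y : EuclideanSpace ℝ (Fin 3)) (hx : ‖x‖ = 1) (hy : ‖y‖ = 1) :
    legP1 (inner ℝ x y) = ∑ m : Fin 3, lam1 m * harm1 m x * harm1 m y := by
  have ex := sum_sq_eq_one_of_norm_eq_one hx
  have ey := sum_sq_eq_one_of_norm_eq_one hy
  rw [real_inner_eq_sum_three, sum_fin3]
  simp only [legP1, lam1, harm1]
  linear_combination (0 : ℝ) * ex + (0 : ℝ) * ey

/-- **`P1` is positive definite on `S²`**: `Σ_{i∈s} Σ_{j∈s} P1(⟪u_i, u_j⟫) ≥ 0` for unit vectors. -/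
theorem sum_sum_legP1_nonneg {ι : Type*} (s : Finset ι) (u : ι → EuclideanSpace ℝ (Fin 3)) (hu : ∀ i ∈ s, ‖u i‖ = 1) :
    0 ≤ ∑ i ∈ s, ∑ j ∈ s, legP1 (inner ℝ (u i) (u j)) :=
  sum_sum_nonneg_of_gram s (fun i j => legP1 (inner ℝ (u i) (u j))) lam1 (fun m i => harm1 m (u i))
    (fun m => by fin_cases m <;> norm_num [lam1])
    (fun i hi j hj => legP1_inner_eq (u i) (u j) (hu i hi) (hu j hj))

/-! ### Degree `2` -/
/-- An integer basis of the harmonic polynomials of degree `2` on `ℝ³` (`5` of them), orthogonal for the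
rotation-invariant (Fischer) inner product, read on the coordinates of a vector of `ℝ³`. -/
def harm2 : Fin 5 → EuclideanSpace ℝ (Fin 3) → ℝ
  | ⟨0, _⟩, x => (x 0 * x 1)
  | ⟨1, _⟩, x => (x 0 * x 2)
  | ⟨2, _⟩, x => (-(x 0 ^ 2) + x 1 ^ 2)
  | ⟨3, _⟩, x => (x 1 * x 2)
  | ⟨4, _⟩, x => (-(x 0 ^ 2) + -(x 1 ^ 2) + (2 : ℝ) * x 2 ^ 2)

/-- The (positive, rational) addition-theorem weights of `harm2`. -/
def lam2 : Fin 5 → ℝ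
  | ⟨0, _⟩ => (3 : ℝ)
  | ⟨1, _⟩ => (3 : ℝ)
  | ⟨2, _⟩ => (3 / 4 : ℝ)
  | ⟨3, _⟩ => (3 : ℝ)
  | ⟨4, _⟩ => (1 / 4 : ℝ)

/-- `P2` on the Gram entries of unit vectors is the explicit sum of products `Σ_m λ_m h_m(x) h_m(y)` (addition theorem,
degree `2`, with rational weights). -/
theorem legP2_inner_eq (x y : EuclideanSpace ℝ (Fin 3)) (hx : ‖x‖ = 1) (hy : ‖y‖ = 1) :
    legP2 (inner ℝ x y) = ∑ m : Fin 5, lam2 m * harm2 m x * harm2 m y := by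
  have ex := sum_sq_eq_one_of_norm_eq_one hx
  have ey := sum_sq_eq_one_of_norm_eq_one hy
  rw [real_inner_eq_sum_three, sum_fin5]
  simp only [legP2, lam2, harm2]
  linear_combination (-((-(1 / 2) : ℝ) * 1 * (1) * (y 0 ^ 2 + y 1 ^ 2 + y 2 ^ 2))) * ex + (-((-(1 / 2) : ℝ) * 1 * (1))) * ey

/-- **`P2` is positive definite on `S²`**: `Σ_{i∈s} Σ_{j∈s} P2(⟪u_i, u_j⟫) ≥ 0` for unit vectors. -/
theorem sum_sum_legP2_nonneg {ι : Type*} (s : Finset ι) (u : ι → EuclideanSpace ℝ (Fin 3)) (hu : ∀ i ∈ s, ‖u i‖ = 1) :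
    0 ≤ ∑ i ∈ s, ∑ j ∈ s, legP2 (inner ℝ (u i) (u j)) :=
  sum_sum_nonneg_of_gram s (fun i j => legP2 (inner ℝ (u i) (u j))) lam2 (fun m i => harm2 m (u i))
    (fun m => by fin_cases m <;> norm_num [lam2])
    (fun i hi j hj => legP2_inner_eq (u i) (u j) (hu i hi) (hu j hj))

/-! ### Degree `3` -/
/-- An integer basis of the harmonic polynomials of degree `3` on `ℝ³` (`7` of them), orthogonal for the
rotation-invariant (Fischer) inner product, read on the coordinates of a vector of `ℝ³`. -/
def harm3 : Fin 7 → EuclideanSpace ℝ (Fin 3) → ℝ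
  | ⟨0, _⟩, x => (-(x 0 ^ 3) + (3 : ℝ) * x 0 * x 1 ^ 2)
  | ⟨1, _⟩, x => (x 0 * x 1 * x 2)
  | ⟨2, _⟩, x => (-(x 0 ^ 3) + -(x 0 * x 1 ^ 2) + (4 : ℝ) * x 0 * x 2 ^ 2)
  | ⟨3, _⟩, x => ((-3 : ℝ) * x 0 ^ 2 * x 1 + x 1 ^ 3)
  | ⟨4, _⟩, x => (-(x 0 ^ 2 * x 2) + x 1 ^ 2 * x 2)
  | ⟨5, _⟩, x => (-(x 0 ^ 2 * x 1) + -(x 1 ^ 3) + (4 : ℝ) * x 1 * x 2 ^ 2)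
  | ⟨6, _⟩, x => ((-3 : ℝ) * x 0 ^ 2 * x 2 + (-3 : ℝ) * x 1 ^ 2 * x 2 + (2 : ℝ) * x 2 ^ 3)

/-- The (positive, rational) addition-theorem weights of `harm3`. -/
def lam3 : Fin 7 → ℝ
  | ⟨0, _⟩ => (5 / 8 : ℝ)
  | ⟨1, _⟩ => (15 : ℝ)
  | ⟨2, _⟩ => (3 / 8 : ℝ)
  | ⟨3, _⟩ => (5 / 8 : ℝ)
  | ⟨4, _⟩ => (15 / 4 : ℝ)
  | ⟨5, _⟩ => (3 / 8 : ℝ)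
  | ⟨6, _⟩ => (1 / 4 : ℝ)

/-- `P3` on the Gram entries of unit vectors is the explicit sum of products `Σ_m λ_m h_m(x) h_m(y)` (addition theorem,
degree `3`, with rational weights). -/
theorem legP3_inner_eq (x y : EuclideanSpace ℝ (Fin 3)) (hx : ‖x‖ = 1) (hy : ‖y‖ = 1) :
    legP3 (inner ℝ x y) = ∑ m : Fin 7, lam3 m * harm3 m x * harm3 m y := by
  have ex := sum_sq_eq_one_of_norm_eq_one hx
  have ey := sum_sq_eq_one_of_norm_eq_one hy
  rw [real_inner_eq_sum_three, sum_fin7]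
  simp only [legP3, lam3, harm3]
  linear_combination (-((-(3 / 2) : ℝ) * (x 0 * y 0 + x 1 * y 1 + x 2 * y 2) * (1) * (y 0 ^ 2 + y 1 ^ 2 + y 2 ^ 2))) * ex + (-((-(3 / 2) : ℝ) * (x 0 * y 0 + x 1 * y 1 + x 2 * y 2) * (1))) * ey

/-- **`P3` is positive definite on `S²`**: `Σ_{i∈s} Σ_{j∈s} P3(⟪u_i, u_j⟫) ≥ 0` for unit vectors. -/
theorem sum_sum_legP3_nonneg {ι : Type*} (s : Finset ι) (u : ι → EuclideanSpace ℝ (Fin 3)) (hu : ∀ i ∈ s, ‖u i‖ = 1) :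
    0 ≤ ∑ i ∈ s, ∑ j ∈ s, legP3 (inner ℝ (u i) (u j)) :=
  sum_sum_nonneg_of_gram s (fun i j => legP3 (inner ℝ (u i) (u j))) lam3 (fun m i => harm3 m (u i))
    (fun m => by fin_cases m <;> norm_num [lam3])
    (fun i hi j hj => legP3_inner_eq (u i) (u j) (hu i hi) (hu j hj))

/-! ### Degree `4` -/
/-- An integer basis of the harmonic polynomials of degree `4` on `ℝ³` (`9` of them), orthogonal for the
rotation-invariant (Fischer) inner product, read on the coordinates of a vector of `ℝ³`. -/
def harm4 : Fin 9 → EuclideanSpace ℝ (Fin 3) → ℝ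
  | ⟨0, _⟩, x => (-(x 0 ^ 3 * x 1) + x 0 * x 1 ^ 3)
  | ⟨1, _⟩, x => (-(x 0 ^ 3 * x 2) + (3 : ℝ) * x 0 * x 1 ^ 2 * x 2)
  | ⟨2, _⟩, x => (-(x 0 ^ 3 * x 1) + -(x 0 * x 1 ^ 3) + (6 : ℝ) * x 0 * x 1 * x 2 ^ 2)
  | ⟨3, _⟩, x => ((-3 : ℝ) * x 0 ^ 3 * x 2 + (-3 : ℝ) * x 0 * x 1 ^ 2 * x 2 + (4 : ℝ) * x 0 * x 2 ^ 3)
  | ⟨4, _⟩, x => (x 0 ^ 4 + (-6 : ℝ) * x 0 ^ 2 * x 1 ^ 2 + x 1 ^ 4)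
  | ⟨5, _⟩, x => ((-3 : ℝ) * x 0 ^ 2 * x 1 * x 2 + x 1 ^ 3 * x 2)
  | ⟨6, _⟩, x => (x 0 ^ 4 + (-6 : ℝ) * x 0 ^ 2 * x 2 ^ 2 + -(x 1 ^ 4) + (6 : ℝ) * x 1 ^ 2 * x 2 ^ 2)
  | ⟨7, _⟩, x => ((-3 : ℝ) * x 0 ^ 2 * x 1 * x 2 + (-3 : ℝ) * x 1 ^ 3 * x 2 + (4 : ℝ) * x 1 * x 2 ^ 3)
  | ⟨8, _⟩, x => ((3 : ℝ) * x 0 ^ 4 + (6 : ℝ) * x 0 ^ 2 * x 1 ^ 2 + (-24 : ℝ) * x 0 ^ 2 * x 2 ^ 2 + (3 : ℝ) * x 1 ^ 4 + (-24 : ℝ) * x 1 ^ 2 * x 2 ^ 2 + (8 : ℝ) * x 2 ^ 4)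

/-- The (positive, rational) addition-theorem weights of `harm4`. -/
def lam4 : Fin 9 → ℝ
  | ⟨0, _⟩ => (35 / 4 : ℝ)
  | ⟨1, _⟩ => (35 / 8 : ℝ)
  | ⟨2, _⟩ => (5 / 4 : ℝ)
  | ⟨3, _⟩ => (5 / 8 : ℝ)
  | ⟨4, _⟩ => (35 / 64 : ℝ)
  | ⟨5, _⟩ => (35 / 8 : ℝ)
  | ⟨6, _⟩ => (5 / 16 : ℝ)
  | ⟨7, _⟩ => (5 / 8 : ℝ)
  | ⟨8, _⟩ => (1 / 64 : ℝ)

/-- `P4` on the Gram entries of unit vectors is the explicit sum of products `Σ_m λ_m h_m(x) h_m(y)` (addition theorem,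
degree `4`, with rational weights). -/
theorem legP4_inner_eq (x y : EuclideanSpace ℝ (Fin 3)) (hx : ‖x‖ = 1) (hy : ‖y‖ = 1) :
    legP4 (inner ℝ x y) = ∑ m : Fin 9, lam4 m * harm4 m x * harm4 m y := by
  have ex := sum_sq_eq_one_of_norm_eq_one hx
  have ey := sum_sq_eq_one_of_norm_eq_one hy
  rw [real_inner_eq_sum_three, sum_fin9]
  simp only [legP4, lam4, harm4]
  linear_combination (-((3 / 8 : ℝ) * 1 * (1 + (x 0 ^ 2 + x 1 ^ 2 + x 2 ^ 2)) * (y 0 ^ 2 + y 1 ^ 2 + y 2 ^ 2) ^ 2 + (-(15 / 4) : ℝ) * (x 0 * y 0 + x 1 * y 1 + x 2 * y 2) ^ 2 * (1) * (y 0 ^ 2 + y 1 ^ 2 + y 2 ^ 2))) * ex + (-((3 / 8 : ℝ) * 1 * (1 + (y 0 ^ 2 + y 1 ^ 2 + y 2 ^ 2)) + (-(15 / 4) : ℝ) * (x 0 * y 0 + x 1 * y 1 + x 2 * y 2) ^ 2 * (1))) * ey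

/-- **`P4` is positive definite on `S²`**: `Σ_{i∈s} Σ_{j∈s} P4(⟪u_i, u_j⟫) ≥ 0` for unit vectors. -/
theorem sum_sum_legP4_nonneg {ι : Type*} (s : Finset ι) (u : ι → EuclideanSpace ℝ (Fin 3)) (hu : ∀ i ∈ s, ‖u i‖ = 1) :
    0 ≤ ∑ i ∈ s, ∑ j ∈ s, legP4 (inner ℝ (u i) (u j)) :=
  sum_sum_nonneg_of_gram s (fun i j => legP4 (inner ℝ (u i) (u j))) lam4 (fun m i => harm4 m (u i))
    (fun m => by fin_cases m <;> norm_num [lam4])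
    (fun i hi j hj => legP4_inner_eq (u i) (u j) (hu i hi) (hu j hj))

/-! ### Degree `5` -/
/-- An integer basis of the harmonic polynomials of degree `5` on `ℝ³` (`11` of them), orthogonal for the
rotation-invariant (Fischer) inner product, read on the coordinates of a vector of `ℝ³`. -/
def harm5 : Fin 11 → EuclideanSpace ℝ (Fin 3) → ℝ
  | ⟨0, _⟩, x => (x 0 ^ 5 + (-10 : ℝ) * x 0 ^ 3 * x 1 ^ 2 + (5 : ℝ) * x 0 * x 1 ^ 4)
  | ⟨1, _⟩, x => (-(x 0 ^ 3 * x 1 * x 2) + x 0 * x 1 ^ 3 * x 2)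
  | ⟨2, _⟩, x => (x 0 ^ 5 + (-2 : ℝ) * x 0 ^ 3 * x 1 ^ 2 + (-8 : ℝ) * x 0 ^ 3 * x 2 ^ 2 + (-3 : ℝ) * x 0 * x 1 ^ 4 + (24 : ℝ) * x 0 * x 1 ^ 2 * x 2 ^ 2)
  | ⟨3, _⟩, x => (-(x 0 ^ 3 * x 1 * x 2) + -(x 0 * x 1 ^ 3 * x 2) + (2 : ℝ) * x 0 * x 1 * x 2 ^ 3)
  | ⟨4, _⟩, x => (x 0 ^ 5 + (2 : ℝ) * x 0 ^ 3 * x 1 ^ 2 + (-12 : ℝ) * x 0 ^ 3 * x 2 ^ 2 + x 0 * x 1 ^ 4 + (-12 : ℝ) * x 0 * x 1 ^ 2 * x 2 ^ 2 + (8 : ℝ) * x 0 * x 2 ^ 4)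
  | ⟨5, _⟩, x => ((5 : ℝ) * x 0 ^ 4 * x 1 + (-10 : ℝ) * x 0 ^ 2 * x 1 ^ 3 + x 1 ^ 5)
  | ⟨6, _⟩, x => (x 0 ^ 4 * x 2 + (-6 : ℝ) * x 0 ^ 2 * x 1 ^ 2 * x 2 + x 1 ^ 4 * x 2)
  | ⟨7, _⟩, x => ((3 : ℝ) * x 0 ^ 4 * x 1 + (2 : ℝ) * x 0 ^ 2 * x 1 ^ 3 + (-24 : ℝ) * x 0 ^ 2 * x 1 * x 2 ^ 2 + -(x 1 ^ 5) + (8 : ℝ) * x 1 ^ 3 * x 2 ^ 2)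
  | ⟨8, _⟩, x => (x 0 ^ 4 * x 2 + (-2 : ℝ) * x 0 ^ 2 * x 2 ^ 3 + -(x 1 ^ 4 * x 2) + (2 : ℝ) * x 1 ^ 2 * x 2 ^ 3)
  | ⟨9, _⟩, x => (x 0 ^ 4 * x 1 + (2 : ℝ) * x 0 ^ 2 * x 1 ^ 3 + (-12 : ℝ) * x 0 ^ 2 * x 1 * x 2 ^ 2 + x 1 ^ 5 + (-12 : ℝ) * x 1 ^ 3 * x 2 ^ 2 + (8 : ℝ) * x 1 * x 2 ^ 4)
  | ⟨10, _⟩, x => ((15 : ℝ) * x 0 ^ 4 * x 2 + (30 : ℝ) * x 0 ^ 2 * x 1 ^ 2 * x 2 + (-40 : ℝ) * x 0 ^ 2 * x 2 ^ 3 + (15 : ℝ) * x 1 ^ 4 * x 2 + (-40 : ℝ) * x 1 ^ 2 * x 2 ^ 3 + (8 : ℝ) * x 2 ^ 5)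

/-- The (positive, rational) addition-theorem weights of `harm5`. -/
def lam5 : Fin 11 → ℝ
  | ⟨0, _⟩ => (63 / 128 : ℝ)
  | ⟨1, _⟩ => (315 / 4 : ℝ)
  | ⟨2, _⟩ => (35 / 128 : ℝ)
  | ⟨3, _⟩ => (105 / 4 : ℝ)
  | ⟨4, _⟩ => (15 / 64 : ℝ)
  | ⟨5, _⟩ => (63 / 128 : ℝ)
  | ⟨6, _⟩ => (315 / 64 : ℝ)
  | ⟨7, _⟩ => (35 / 128 : ℝ)
  | ⟨8, _⟩ => (105 / 16 : ℝ)
  | ⟨9, _⟩ => (15 / 64 : ℝ)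
  | ⟨10, _⟩ => (1 / 64 : ℝ)

/-- `P5` on the Gram entries of unit vectors is the explicit sum of products `Σ_m λ_m h_m(x) h_m(y)` (addition theorem,
degree `5`, with rational weights). -/
theorem legP5_inner_eq (x y : EuclideanSpace ℝ (Fin 3)) (hx : ‖x‖ = 1) (hy : ‖y‖ = 1) :
    legP5 (inner ℝ x y) = ∑ m : Fin 11, lam5 m * harm5 m x * harm5 m y := by
  have ex := sum_sq_eq_one_of_norm_eq_one hx
  have ey := sum_sq_eq_one_of_norm_eq_one hy
  rw [real_inner_eq_sum_three, sum_fin11]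
  simp only [legP5, lam5, harm5]
  linear_combination (-((15 / 8 : ℝ) * (x 0 * y 0 + x 1 * y 1 + x 2 * y 2) * (1 + (x 0 ^ 2 + x 1 ^ 2 + x 2 ^ 2)) * (y 0 ^ 2 + y 1 ^ 2 + y 2 ^ 2) ^ 2 + (-(35 / 4) : ℝ) * (x 0 * y 0 + x 1 * y 1 + x 2 * y 2) ^ 3 * (1) * (y 0 ^ 2 + y 1 ^ 2 + y 2 ^ 2))) * ex + (-((15 / 8 : ℝ) * (x 0 * y 0 + x 1 * y 1 + x 2 * y 2) * (1 + (y 0 ^ 2 + y 1 ^ 2 + y 2 ^ 2)) + (-(35 / 4) : ℝ) * (x 0 * y 0 + x 1 * y 1 + x 2 * y 2) ^ 3 * (1))) * ey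

/-- **`P5` is positive definite on `S²`**: `Σ_{i∈s} Σ_{j∈s} P5(⟪u_i, u_j⟫) ≥ 0` for unit vectors. -/
theorem sum_sum_legP5_nonneg {ι : Type*} (s : Finset ι) (u : ι → EuclideanSpace ℝ (Fin 3)) (hu : ∀ i ∈ s, ‖u i‖ = 1) :
    0 ≤ ∑ i ∈ s, ∑ j ∈ s, legP5 (inner ℝ (u i) (u j)) :=
  sum_sum_nonneg_of_gram s (fun i j => legP5 (inner ℝ (u i) (u j))) lam5 (fun m i => harm5 m (u i))
    (fun m => by fin_cases m <;> norm_num [lam5])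
    (fun i hi j hj => legP5_inner_eq (u i) (u j) (hu i hi) (hu j hj))

end Summit.AtomisticToContinuum.Crystallization.Theorems.StrictSplittingRuleBirth

end
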